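import Summits.NavierStokesRegularity.NavierStokesRegularity.Theorems.SqueezeCycleExtremalBiaxialitySubcriticalSmallConstant
import Summits.NavierStokesRegularity.NavierStokesRegularity.Theorems.CorkscrewDynamoCorkscrewProfileRdssIterate
import Literature.Analysis.FluidPDE.ChaeWolfRemovingDSSLimit
import HarnessLib

/-!
# Route CorkscrewDynamo · crux `CorkscrewProfile` (stmt-NavierStokesRegularity-11282) — the uniform
# nontriviality witness of a rotated-DSS Type-I field in one period (lead c4, line `registered`, tool stub F2)

Registered tool stub `stub_rdssWitness` of the near-identity rigidity theorem: Chae–Wolf 2017, §3 Step 1,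
WITH ROTATIONS and in the Oseen (KNSS) gauge. There is an absolute `ε₀ > 0` (the small-constant threshold of
`exists_typeIAncientMild_eq_zero_of_small`) such that every nontrivial Oseen-gauge Type-I field
`V ∈ IsTypeIAncientMild C₀` with the space-time Type-I bound `HasTypeIDecay C₀ V`, rotated `c`-DSS about `e₃`
through `rotZLIE θ` with `1 < c ≤ 2`, has a witness point `t ∈ [−c², −1]`, `‖x‖ ≤ 2C₀/ε₀` with
`‖V(t, x)‖ ≥ ε₀/2`.

Proof (the tree's plain-DSS `Literature.Analysis.FluidPDE.ChaeWolf.exists_witness`, with the rotated scaling):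
* if the scale-invariant quantity `q(t, x) := √(−t) ‖V(t, x)‖` were `≤ ε₀` everywhere, `V` would lie in
  `IsTypeIAncientMild ε₀` and vanish identically (`exists_typeIAncientMild_eq_zero_of_small`); so some
  `q(t', x') > ε₀`;
* a rotated `C`-DSS law `C R⁻¹ V(C²t, C R x) = V(t, x)` preserves `q`: `q(C² t, C R x) = q(t, x)`
  (`IsRotatedDSS.sqrt_neg_mul_norm_eq`), and the iterates `(cᵏ, R_{kθ})` / inverse pairs `((cᵏ)⁻¹, R_{−kθ})` of
  the landed algebra file `CorkscrewDynamoCorkscrewProfileRdssIterate` move `t'` into the period `[−c², −1]`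
  (`exists_nat_pow_near` picks the exponent);
* `ChaeWolf.witness_of_point` converts `q > ε₀` at such a time into the two printed inequalities.
-/

noncomputable section

open Set Function Literature.Analysis.FluidPDE

namespace Summit.NavierStokesRegularity.NavierStokesRegularity.Theorems.CorkscrewProfile.Birth

set_option linter.dupNamespace false

/-! ### The scale-invariant quantity `√(−t) ‖u(t, x)‖` under a rotated DSS law -/

section Algebra

variable {E : Type*} [NormedAddCommGroup E] [NormedSpace ℝ E]

/-- Pointwise norm form of a rotated `C`-DSS law with `0 ≤ C`: `‖u(t, x)‖ = C ‖u(C²t, C R x)‖`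
(`R⁻¹` is an isometry). -/
theorem IsRotatedDSS.norm_eq_mul {C : ℝ} {R : E ≃ₗᵢ[ℝ] E} {u : ℝ → E → E}
    (h : IsRotatedDSS C R u) (hC : 0 ≤ C) (t : ℝ) (x : E) :
    ‖u t x‖ = C * ‖u (C ^ 2 * t) (C • R x)‖ := by
  rw [← h t x, norm_smul, LinearIsometryEquiv.norm_map, Real.norm_of_nonneg hC]

/-- **A rotated DSS law preserves the scale-invariant quantity** `q(t, x) = √(−t) ‖u(t, x)‖`:
`q(C²t, C R x) = q(t, x)` (`√(−C²t) = C √(−t)` for `0 ≤ C`). -/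
theorem IsRotatedDSS.sqrt_neg_mul_norm_eq {C : ℝ} {R : E ≃ₗᵢ[ℝ] E} {u : ℝ → E → E}
    (h : IsRotatedDSS C R u) (hC : 0 ≤ C) (t : ℝ) (x : E) :
    Real.sqrt (-(C ^ 2 * t)) * ‖u (C ^ 2 * t) (C • R x)‖ = Real.sqrt (-t) * ‖u t x‖ := by
  rw [IsRotatedDSS.norm_eq_mul h hC t x, show -(C ^ 2 * t) = C ^ 2 * -t by ring,
    Real.sqrt_mul (sq_nonneg C), Real.sqrt_sq hC]
  ring

/-- Transport of a point with large scale-invariant quantity along a rotated `C`-DSS law: from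
`ε₀ < q(t', x')` to a point at the rescaled time `C² t'`. -/
theorem IsRotatedDSS.exists_point_scaled {C ε₀ t' : ℝ} {R : E ≃ₗᵢ[ℝ] E} {u : ℝ → E → E} {x' : E}
    (h : IsRotatedDSS C R u) (hC : 0 ≤ C) (hq' : ε₀ < Real.sqrt (-t') * ‖u t' x'‖) :
    ∃ x : E, ε₀ < Real.sqrt (-(C ^ 2 * t')) * ‖u (C ^ 2 * t') x‖ :=
  ⟨C • R x', by rwa [IsRotatedDSS.sqrt_neg_mul_norm_eq h hC]⟩

end Algebra

/-! ### Moving the point into one period -/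

/-- **Into the fundamental period.** For a field rotated `c`-DSS about `e₃` with `1 < c`, a point `t' < 0`
with `ε₀ < √(−t') ‖u(t', x')‖` can be moved to a time `t ∈ [−c², −1]`: if `1 ≤ −t'`, with
`(c²)ⁿ ≤ −t' < (c²)ⁿ⁺¹`, scale towards `t = 0` by the inverse pair `((cⁿ)⁻¹, R_{−nθ})`; if `−t' < 1`, with
`(c²)ⁿ ≤ 1/(−t') < (c²)ⁿ⁺¹`, scale away from `t = 0` by the iterate `(cⁿ⁺¹, R_{(n+1)θ})`. -/
theorem IsRotatedDSS.exists_mem_Icc_of_rotZ {c θ ε₀ t' : ℝ}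
    {u : ℝ → EuclideanSpace ℝ (Fin 3) → EuclideanSpace ℝ (Fin 3)} {x' : EuclideanSpace ℝ (Fin 3)}
    (hc1 : 1 < c) (h : IsRotatedDSS c (rotZLIE θ) u) (ht' : t' < 0)
    (hq' : ε₀ < Real.sqrt (-t') * ‖u t' x'‖) :
    ∃ t ∈ Icc (-c ^ 2) (-1), ∃ x : EuclideanSpace ℝ (Fin 3), ε₀ < Real.sqrt (-t) * ‖u t x‖ := by
  have hc0 : 0 < c := by linarith
  have hc2' : 1 < c ^ 2 := by nlinarith
  have hM0 : ∀ k : ℕ, (0 : ℝ) < (c ^ 2) ^ k := fun k => pow_pos (pow_pos hc0 2) k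
  rcases le_or_gt 1 (-t') with h1 | h1
  · -- `1 ≤ -t'`, `(c²)ⁿ ≤ -t' < (c²)ⁿ⁺¹`: scale towards `t = 0` by `((cⁿ)⁻¹, R_{-nθ})`
    obtain ⟨n, hn1, hn2⟩ := exists_nat_pow_near h1 hc2'
    obtain ⟨x, hx⟩ := IsRotatedDSS.exists_point_scaled
      (IsRotatedDSS.rotZ_inv (pow_pos hc0 n) (IsRotatedDSS.rotZ_iterate h n))
      (inv_pos.2 (pow_pos hc0 n)).le hq'
    have e : (c ^ n)⁻¹ ^ 2 * t' = t' / (c ^ 2) ^ n := by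
      rw [inv_pow, ← pow_mul, ← pow_mul, mul_comm n 2, inv_mul_eq_div]
    rw [e] at hx
    refine ⟨t' / (c ^ 2) ^ n, ⟨?_, ?_⟩, x, hx⟩
    · rw [le_div_iff₀ (hM0 n)]
      rw [pow_succ (c ^ 2) n] at hn2
      linarith
    · rw [div_le_iff₀ (hM0 n)]
      linarith
  · -- `-t' < 1`, `(c²)ⁿ ≤ 1/(-t') < (c²)ⁿ⁺¹`: scale away from `t = 0` by `(cⁿ⁺¹, R_{(n+1)θ})`
    have ht0 : 0 < -t' := neg_pos.2 ht'
    have hx1 : 1 ≤ 1 / -t' := by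
      rw [le_div_iff₀ ht0, one_mul]
      exact h1.le
    obtain ⟨n, hn1, hn2⟩ := exists_nat_pow_near hx1 hc2'
    obtain ⟨x, hx⟩ := IsRotatedDSS.exists_point_scaled (IsRotatedDSS.rotZ_iterate h (n + 1))
      (pow_pos hc0 (n + 1)).le hq'
    have e : (c ^ (n + 1)) ^ 2 * t' = (c ^ 2) ^ (n + 1) * t' := by
      rw [← pow_mul, ← pow_mul, mul_comm (n + 1) 2]
    rw [e] at hx
    refine ⟨(c ^ 2) ^ (n + 1) * t', ⟨?_, ?_⟩, x, hx⟩
    · have h3 : (c ^ 2) ^ n * -t' ≤ 1 := by rwa [le_div_iff₀ ht0] at hn1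
      have h4 : c ^ 2 * ((c ^ 2) ^ n * -t') ≤ c ^ 2 * 1 :=
        mul_le_mul_of_nonneg_left h3 (sq_nonneg c)
      rw [pow_succ (c ^ 2) n]
      linarith
    · have h3 : 1 < (c ^ 2) ^ (n + 1) * -t' := by rwa [div_lt_iff₀ ht0] at hn2
      linarith

/-! ### The registered signature -/

/-- **Tool stub F2 `stub_rdssWitness` — Chae–Wolf 2017 §3 Step 1 with rotations, Oseen gauge.** There is an
absolute `ε₀ > 0` such that every NONTRIVIAL Oseen-gauge Type-I field (`IsTypeIAncientMild C₀ V`,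
`HasTypeIDecay C₀ V`) which is rotated `c`-DSS about `e₃`, `1 < c ≤ 2`, has a witness point `t ∈ [−c², −1]`,
`‖x‖ ≤ 2C₀/ε₀`, `‖V(t,x)‖ ≥ ε₀/2`: the smallness theorem `exists_typeIAncientMild_eq_zero_of_small` gives a
point with `√(−t)‖V‖ > ε₀` (else `V ∈ IsTypeIAncientMild ε₀` vanishes); the rotated scaling, which preserves
`√(−t)‖V‖`, moves it into one period (`IsRotatedDSS.exists_mem_Icc_of_rotZ`); `ChaeWolf.witness_of_point`
concludes. -/
theorem stub_rdssWitness :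
    ∃ ε₀ : ℝ, 0 < ε₀ ∧ ∀ (C₀ c θ : ℝ) (V : ℝ → EuclideanSpace ℝ (Fin 3) → EuclideanSpace ℝ (Fin 3)), 1 < c → c ≤ 2 →
      Literature.Analysis.FluidPDE.IsTypeIAncientMild C₀ V → Literature.Analysis.FluidPDE.HasTypeIDecay C₀ V →
      Literature.Analysis.FluidPDE.IsRotatedDSS c (Literature.Analysis.FluidPDE.rotZLIE θ) V →
      (∃ t < 0, ∃ x, V t x ≠ 0) →
      ∃ t ∈ Set.Icc (-c ^ 2) (-1), ∃ x : EuclideanSpace ℝ (Fin 3), ‖x‖ ≤ 2 * C₀ / ε₀ ∧ ε₀ / 2 ≤ ‖V t x‖ := by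
  obtain ⟨ε₀, hε₀, hsmall⟩ := exists_typeIAncientMild_eq_zero_of_small
  refine ⟨ε₀, hε₀, fun C₀ c θ V hc1 hc2 hV hI hrdss hnt => ?_⟩
  -- a point with a large scale-invariant quantity
  obtain ⟨t', ht', x', hq'⟩ : ∃ t' < 0, ∃ x', ε₀ < Real.sqrt (-t') * ‖V t' x'‖ := by
    by_contra hcon
    push Not at hcon
    obtain ⟨t, ht, x, hx⟩ := hnt
    have hdec : HasTypeITimeDecay ε₀ V := by
      intro s hs y
      rw [le_div_iff₀ (Real.sqrt_pos.2 (neg_pos.2 hs)), mul_comm]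
      exact hcon s hs y
    exact hx (hsmall ε₀ V ⟨hV.1, hV.2.1, hV.2.2.1, hdec⟩ le_rfl t ht x)
  -- move it into the period `[-c², -1]` and conclude
  obtain ⟨t, ht, x, hq⟩ := IsRotatedDSS.exists_mem_Icc_of_rotZ hc1 hrdss ht' hq'
  exact ⟨t, ht, x, ChaeWolf.witness_of_point hε₀ hV.nonneg (by linarith) hc2 hI ht hq⟩

end Summit.NavierStokesRegularity.NavierStokesRegularity.Theorems.CorkscrewProfile.Birth
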